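import Summits.AtomisticToContinuum.FouriersLaw.Theorems.JunctionLocalityNonBallisticDrudeLineDefs
import Summits.AtomisticToContinuum.FouriersLaw.Theorems.JunctionLocalityNonBallisticStubAutocorrelationContinuous
import Summits.AtomisticToContinuum.FouriersLaw.Theorems.JunctionLocalityNonBallisticStubTimeIntegratedCurrentMean
import Summits.AtomisticToContinuum.FouriersLaw.Theorems.JunctionLocalityNonBallisticStubEquilibriumTimeIntegratedCurrentVariance
import Summits.AtomisticToContinuum.FouriersLaw.Theorems.JunctionLocalityNonBallisticStubTimeIntegratedCurrentVarianceContinuity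
import Summits.AtomisticToContinuum.FouriersLaw.Theorems.JunctionLocalityNonBallisticStubTotalHeatPathwiseIdentity
import Summits.AtomisticToContinuum.FouriersLaw.Theorems.JunctionLocalityNonBallisticStubTotalCurrentFTURTransfer

/-!
# `NonBallistic` (stmt-AtomisticToContinuum-9127) from the windowed sub-ballistic equilibrium variance and (K)

Line `drude-controls-conductance`, reshape R1 (lead c2), with its six fixed-`N` stubs LANDED
(`stub_autocorrelationContinuous` p121259, `stub_timeIntegratedCurrentMean` p123125, `stub_equilibriumTimeIntegratedCurrentVariance` p121435,
`stub_timeIntegratedCurrentVarianceContinuity` p123085, `stub_totalHeatPathwiseIdentity` p121901, `stub_totalCurrentFTURTransfer` p121654):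
the crux `JunctionLocality.NonBallistic` (shared verbatim by `PuiseuxTransferLedger` / `BondHeatUncertainty`) follows from TWO named statements,

* (K) `BondHeatUncertainty.ExtensiveSnapshotIrreversibility` (route item stmt-AtomisticToContinuum-9121: `KL(μ_{N,δ}‖Θ_*μ_{N,δ}) ≤ C·N·δ²`
  eventually), and
* `DrudeLine.SubballisticTransitWindow` (`∃ a ∀ ε ∃ N₀ ∀ N ≥ N₀ ∃ τ ∈ (0, aN]`, `Var_eq,N(Φ_τ) = 2∫₀^τ(τ-s)C_N(s)ds ≤ εNτ²` — zero Drude weight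
  of the pinned anharmonic chain in finite-`N` windowed form; the ONLY statement here using `lam, β > 0`),

through the PROVED total-current fluctuation-theorem uncertainty relation `2(D_Nτ)² ≤ Var_eq,N(Φ_τ)·(G_Nτ/T² + K_N)` (Hasegawa–Van Vu on the
endpoint–heat marginal of ★ `LinearResponseFTUR`, with the flip-odd total-heat observable `(N-1)Q_L - ΔM`): a conductance floor `G_N > ε`
would make `2D_N² ≤ D_N·N·2ε'(a/T² + C⁺/ε)`, absurd for `ε'` small. This is the tree form of the line's composition `NonBallistic_of`
(`Cruxes/NonBallistic/Lines/drude_controls_conductance.lean`); it is the third kernel-checked two-hypothesis reduction of the crux after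
`nonBallistic_of_coneScaleCorrector` / `nonBallistic_of_subcubicCorrector` (lead c1) and the contact-profile composition of line
`contact-current-forgetting`. Nothing here closes the item: `SubballisticTransitWindow` is open (crux-sized: zero Drude weight) and (K) is staffed.
-/

noncomputable section

namespace Summit.AtomisticToContinuum.FouriersLaw.Theorems.NonBallistic

open MeasureTheory ProbabilityTheory Filter Topology
open scoped NNReal ENNReal BigOperators
open Literature.MathematicalPhysics.KineticTheory
open Literature.MathematicalPhysics.KineticTheory.HeatConduction
open Summit.AtomisticToContinuum.FouriersLaw.Theorems.NonBallistic.DrudeLine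

/-- Real-arithmetic core of the composition: the FTUR at `(N, τ, K = C⁺N)` with a sub-ballistic window variance and `τ ≤ aN`
contradicts a conductance floor `D > ε(N-1)` once `2ε'(a/T² + C⁺/ε) ≤ ε/2`. -/
theorem DrudeWindow.no_floor_of_ftur {D V τ a T ε ε' Cp : ℝ} {N : ℕ} (hN : 2 ≤ N) (hT : 0 < T) (hε : 0 < ε) (hε' : 0 ≤ ε')
    (hCp : 0 ≤ Cp) (hτ : 0 < τ) (hτa : τ ≤ a * (N : ℝ))
    (hsmall : 2 * ε' * (a / T ^ 2 + Cp / ε) ≤ ε / 2)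
    (hV : V ≤ ε' * (N : ℝ) * τ ^ 2)
    (hF : 2 * D ^ 2 * τ ^ 2 ≤ V * (D / ((N : ℝ) - 1) * τ / T ^ 2 + Cp * (N : ℝ)))
    (hfloor : ε * ((N : ℝ) - 1) < D) : False := by
  have hN2 : (2 : ℝ) ≤ (N : ℝ) := by exact_mod_cast hN
  have hNm1 : 0 < (N : ℝ) - 1 := by linarith
  have hNpos : (0 : ℝ) < (N : ℝ) := by linarith
  have hD : 0 < D := lt_of_le_of_lt (by positivity) hfloor
  have hT2 : 0 < T ^ 2 := by positivity
  have hfac : 0 ≤ D / ((N : ℝ) - 1) * τ / T ^ 2 + Cp * (N : ℝ) := by positivity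
  -- FTUR × window, divided by τ²
  have h1 : 2 * D ^ 2 * τ ^ 2 ≤ ε' * (N : ℝ) * τ ^ 2 * (D / ((N : ℝ) - 1) * τ / T ^ 2 + Cp * (N : ℝ)) :=
    hF.trans (mul_le_mul_of_nonneg_right hV hfac)
  have hτ2 : 0 < τ ^ 2 := by positivity
  have h2 : 2 * D ^ 2 ≤ ε' * (N : ℝ) * (D / ((N : ℝ) - 1) * τ / T ^ 2 + Cp * (N : ℝ)) := by
    have h' : 2 * D ^ 2 * τ ^ 2 ≤ (ε' * (N : ℝ) * (D / ((N : ℝ) - 1) * τ / T ^ 2 + Cp * (N : ℝ))) * τ ^ 2 := by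
      nlinarith [h1]
    exact le_of_mul_le_mul_right h' hτ2
  -- term A: `ε' N · Dτ/((N-1)T²) ≤ D · (2ε'a/T²) · N`
  have hNratio : (N : ℝ) / ((N : ℝ) - 1) ≤ 2 := by
    rw [div_le_iff₀ hNm1]; linarith
  have hA : ε' * (N : ℝ) * (D / ((N : ℝ) - 1) * τ / T ^ 2) ≤ D * (2 * ε' * a / T ^ 2) * (N : ℝ) := by
    have e : ε' * (N : ℝ) * (D / ((N : ℝ) - 1) * τ / T ^ 2) =
        D * ((N : ℝ) / ((N : ℝ) - 1)) * (ε' / T ^ 2) * τ := by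
      field_simp
    rw [e]
    have h3 : D * ((N : ℝ) / ((N : ℝ) - 1)) * (ε' / T ^ 2) * τ ≤ D * 2 * (ε' / T ^ 2) * (a * (N : ℝ)) := by
      have hc : 0 ≤ ε' / T ^ 2 := by positivity
      have h4 : D * ((N : ℝ) / ((N : ℝ) - 1)) ≤ D * 2 := mul_le_mul_of_nonneg_left hNratio hD.le
      have h5 : 0 ≤ D * ((N : ℝ) / ((N : ℝ) - 1)) * (ε' / T ^ 2) := by positivity
      calc D * ((N : ℝ) / ((N : ℝ) - 1)) * (ε' / T ^ 2) * τ
          ≤ D * ((N : ℝ) / ((N : ℝ) - 1)) * (ε' / T ^ 2) * (a * (N : ℝ)) :=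
            mul_le_mul_of_nonneg_left hτa h5
        _ ≤ D * 2 * (ε' / T ^ 2) * (a * (N : ℝ)) := by
            have h6 : 0 ≤ a * (N : ℝ) := le_trans hτ.le hτa
            have h7 := mul_le_mul_of_nonneg_right h4 hc
            exact mul_le_mul_of_nonneg_right h7 h6
    calc D * ((N : ℝ) / ((N : ℝ) - 1)) * (ε' / T ^ 2) * τ ≤ D * 2 * (ε' / T ^ 2) * (a * (N : ℝ)) := h3
      _ = D * (2 * ε' * a / T ^ 2) * (N : ℝ) := by ring
  -- term B: `ε' N · C⁺N ≤ D · (2ε'C⁺/ε) · N` from `εN ≤ 2D`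
  have hDN : ε * (N : ℝ) ≤ 2 * D := by nlinarith
  have hB : ε' * (N : ℝ) * (Cp * (N : ℝ)) ≤ D * (2 * ε' * Cp / ε) * (N : ℝ) := by
    have e : D * (2 * ε' * Cp / ε) * (N : ℝ) = (ε' * Cp / ε) * (2 * D) * (N : ℝ) := by ring
    rw [e]
    have h3 : ε' * (N : ℝ) * (Cp * (N : ℝ)) = (ε' * Cp / ε) * (ε * (N : ℝ)) * (N : ℝ) := by
      field_simp
    rw [h3]
    have hc : 0 ≤ ε' * Cp / ε := by positivity
    have h4 : (ε' * Cp / ε) * (ε * (N : ℝ)) ≤ (ε' * Cp / ε) * (2 * D) := mul_le_mul_of_nonneg_left hDN hc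
    exact mul_le_mul_of_nonneg_right h4 hNpos.le
  -- combine
  have h3 : 2 * D ^ 2 ≤ D * (N : ℝ) * (2 * ε' * (a / T ^ 2 + Cp / ε)) := by
    have hsplit : ε' * (N : ℝ) * (D / ((N : ℝ) - 1) * τ / T ^ 2 + Cp * (N : ℝ)) =
        ε' * (N : ℝ) * (D / ((N : ℝ) - 1) * τ / T ^ 2) + ε' * (N : ℝ) * (Cp * (N : ℝ)) := by ring
    rw [hsplit] at h2
    calc 2 * D ^ 2 ≤ ε' * (N : ℝ) * (D / ((N : ℝ) - 1) * τ / T ^ 2) + ε' * (N : ℝ) * (Cp * (N : ℝ)) := h2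
      _ ≤ D * (2 * ε' * a / T ^ 2) * (N : ℝ) + D * (2 * ε' * Cp / ε) * (N : ℝ) := add_le_add hA hB
      _ = D * (N : ℝ) * (2 * ε' * (a / T ^ 2 + Cp / ε)) := by ring
  have h4 : 2 * D ^ 2 ≤ D * (N : ℝ) * (ε / 2) :=
    h3.trans (mul_le_mul_of_nonneg_left hsmall (by positivity))
  -- divide by `D > 0`: `2D ≤ Nε/2`, against `D > ε(N-1) ≥ εN/2`
  have h5 : 2 * D ≤ (N : ℝ) * (ε / 2) := by
    have h' : (2 * D) * D ≤ ((N : ℝ) * (ε / 2)) * D := by nlinarith [h4]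
    exact le_of_mul_le_mul_right h' hD
  nlinarith [h5, hfloor, hN2, hε]

/-- **`NonBallistic` from the window statement and (K)** — the line `drude-controls-conductance` (R1) with its six fixed-`N`
stubs fed from the tree: the total-current FTUR (`stub_totalCurrentFTURTransfer` applied to `stub_timeIntegratedCurrentMean`,
`stub_equilibriumTimeIntegratedCurrentVariance`, `stub_timeIntegratedCurrentVarianceContinuity`, `stub_totalHeatPathwiseIdentity`),
`stub_autocorrelationContinuous`, the route item (K) `ExtensiveSnapshotIrreversibility` (stmt-AtomisticToContinuum-9121) and the
windowed sub-ballistic equilibrium variance `SubballisticTransitWindow` (the line's only open stub = `transit-entropy-pairing`'s stub 4)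
give the crux. Registered sub-goal `nonBallistic_of_subballisticTransitWindow` of stmt-AtomisticToContinuum-9127. -/
theorem nonBallistic_of_subballisticTransitWindow :
    Summit.AtomisticToContinuum.FouriersLaw.Theses.BondHeatUncertainty.ExtensiveSnapshotIrreversibility →
      SubballisticTransitWindow → Summit.AtomisticToContinuum.FouriersLaw.Theses.JunctionLocality.NonBallistic := by
  intro hK hW
  have hA : AutocorrelationContinuous := stub_autocorrelationContinuous
  have hF : TotalCurrentFTUR := stub_totalCurrentFTURTransfer stub_timeIntegratedCurrentMean
    stub_equilibriumTimeIntegratedCurrentVariance stub_timeIntegratedCurrentVarianceContinuity stub_totalHeatPathwiseIdentity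
  intro ω₂ lam β γ hω hl hβ hγ huniq μ hμ T hT D hD ε hε N₀
  -- the equilibrium total-current autocorrelation, keyed once for all stubs
  set Cf : ℕ → ℝ → ℝ := fun (N : ℕ) (s : ℝ) =>
      ∫ x, (∑ i : Fin N, (pinnedChain ω₂ lam β γ).bondCurrent N i x) *
        (∫ y, (∑ i : Fin N, (pinnedChain ω₂ lam β γ).bondCurrent N i y)
          ∂((pinnedChain ω₂ lam β γ).transitionKernel N T T s.toNNReal x))
        ∂((pinnedChain ω₂ lam β γ).gibbsMeasure N T) with hCf
  have hA' : ∀ N : ℕ, Continuous (Cf N) := hA ω₂ lam β γ hω hl hβ hγ T hT Cf hCf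
  obtain ⟨C, hC⟩ := hK ω₂ lam β γ hω hl hβ hγ huniq μ hμ T hT
  obtain ⟨a, ha, hWa⟩ := hW ω₂ lam β γ hω hl hβ hγ T hT Cf hCf
  have hF' := hF ω₂ lam β γ hω hl hβ hγ huniq μ hμ T hT D hD Cf hCf
  -- constants
  set Cp : ℝ := max C 0 with hCp
  have hCp0 : 0 ≤ Cp := le_max_right _ _
  set K₁ : ℝ := a / T ^ 2 + Cp / ε + 1 with hK₁
  have hK₁pos : 0 < K₁ := by rw [hK₁]; positivity
  set ε' : ℝ := ε / (4 * K₁) with hε'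
  have hε'pos : 0 < ε' := by rw [hε']; positivity
  have hsmall : 2 * ε' * (a / T ^ 2 + Cp / ε) ≤ ε / 2 := by
    have h1 : a / T ^ 2 + Cp / ε ≤ K₁ := by rw [hK₁]; linarith
    have h2 : 2 * ε' * (a / T ^ 2 + Cp / ε) ≤ 2 * ε' * K₁ := mul_le_mul_of_nonneg_left h1 (by positivity)
    have h3 : 2 * ε' * K₁ = ε / 2 := by
      rw [hε']; field_simp; ring
    linarith
  -- the window stub at ε'
  obtain ⟨N₁, hN₁⟩ := hWa ε' hε'pos
  refine ⟨max (max N₀ N₁) 2, le_trans (le_max_left _ _) (le_max_left _ _), ?_⟩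
  set N : ℕ := max (max N₀ N₁) 2 with hNdef
  have hNN₁ : N₁ ≤ N := le_trans (le_max_right _ _) (le_max_left _ _)
  have hN2 : 2 ≤ N := le_max_right _ _
  obtain ⟨τ, hτ, hτa, hVτ⟩ := hN₁ N hNN₁
  by_contra hcon
  push Not at hcon
  -- (K) at this N, with the constant enlarged to Cp * N ≥ 0
  have hNreal : (0 : ℝ) ≤ (N : ℝ) := by positivity
  have hKL : ∀ᶠ δ in 𝓝[≠] (0 : ℝ),
      InformationTheory.klDiv (μ N (T + δ / 2) (T - δ / 2))
        ((μ N (T + δ / 2) (T - δ / 2)).map (fun x : PhaseSpace N => (x.1, -x.2)))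
          ≤ ENNReal.ofReal (Cp * (N : ℝ) * δ ^ 2) := by
    filter_upwards [hC N] with δ hδ
    refine le_trans hδ (ENNReal.ofReal_le_ofReal ?_)
    have : C ≤ Cp := le_max_left _ _
    have hδ2 : 0 ≤ (N : ℝ) * δ ^ 2 := by positivity
    nlinarith
  have hKnn : 0 ≤ Cp * (N : ℝ) := by positivity
  -- the total-current FTUR at (N, τ, Cp * N), fed with stub 1's continuity
  have hstar := hF' N hN2 (hA' N) τ hτ (Cp * (N : ℝ)) hKnn hKL
  exact DrudeWindow.no_floor_of_ftur hN2 hT hε hε'pos.le hCp0 hτ hτa hsmall hVτ hstar hcon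


end Summit.AtomisticToContinuum.FouriersLaw.Theorems.NonBallistic

end
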